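import Summits.Ventures.PercRepro.S1CoreCapSixOne
import Summits.Ventures.PercRepro.S1CoreCapSixTwoHeavy

/-!
# PercRepro — TOWARDS `Q*(6) = 16`: ONE BIG LINE, THE CASES (p1, gen 25)

The case analysis for exactly one line `A` of `≥ 4` points (`S1CoreCapSixOne` supplies the budget and the degree
bounds). (α) Some other line `B` carries two fat points off `A`: a second line placed after `B` costs `2 + 2`
more, so `A` is a simple 4-point line and the other lines are chords through one hub with distinct points on
`B` — at most three, each of cap `≤ 2` (`sum_cap_le_of_two_new_fat`). (β) Every other line carries at most one
fat point off `A`: two new fat points on distinct lines force `A = (4,0)` with at most one line through each and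
no other line; one new fat point `q` bounds the lines through `q` and the lines avoiding it; no new fat point
leaves the counting lemma. The cap sum of the other lines is their number plus the degrees of the fat points
(`sum_cap_eq_card_add_sum_fat'`, `sum_fat_eq_sum_deg`), and every branch gives `cap A + cap T ≤ 16`
(`sum_cap_le_sixteen_of_one_big`). `proofs/P1-S4-CAPBRIDGE.md` §17. Axioms: standard.
-/

namespace PercRepro

namespace S1

namespace FourCap

variable {β : Type} [DecidableEq β]

section OneBigCases

variable {w : β → ℕ} {ls : Finset (Finset β)}
  (h1 : ∀ L ∈ ls, ∀ v ∈ L, w v = 1 ∨ w v = 2)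
  (h2 : ∀ L ∈ ls, 3 ≤ L.card ∧ wsum w L ≤ 5)
  (h3 : ∀ L ∈ ls, ∀ L' ∈ ls, L ≠ L' → (L ∩ L').card ≤ 1)
  (h4 : ∀ l : List (Finset β), l.Nodup → (∀ L ∈ l, L ∈ ls) → wsum w (unionL l) ≤ 6 + lineRank l)
  {A : Finset β} (hA : A ∈ ls) (cA : 4 ≤ A.card)
  (hrest : ∀ L ∈ ls, L ≠ A → L.card = 3)

include h3 hA hrest in
/-- A line other than `A` is not covered by `A` nor by `B ∪ A` for another line `B`. -/
theorem not_subset_union_A {X B : Finset β} (hX : X ∈ ls) (hXA : X ≠ A) (hB : B ∈ ls) (hXB : X ≠ B) :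
    ¬ X ⊆ B ∪ A := by
  intro hsub
  have hc := hrest X hX hXA
  have hXU : X ∩ (B ∪ A) = X := Finset.inter_eq_left.2 hsub
  have hle := card_inter_union_le X B A
  rw [hXU] at hle
  have := h3 X hX B hB hXB
  have := h3 X hX A hA hXA
  omega

include h1 h2 h3 h4 hA cA hrest in
/-- **(α) A line with two fat points off `A`: cap sum `≤ 16`.** -/
theorem sum_cap_le_of_two_new_fat {B : Finset β} (hB : B ∈ ls) (hBA : B ≠ A) (hf : 2 ≤ fat w (B \ A)) :
    ∑ L ∈ ls, capPaper L.card (fat w L) ≤ 16 := by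
  have h2A := h2 A hA
  have hwA := wsum_eq_card_add_fat w A (h1 A hA)
  have hwB := wsum_eq_card_add_fat w B (h1 B hB)
  have kB := hrest B hB hBA
  have hfB : fat w (B \ A) + fat w (B ∩ A) = fat w B := fat_sdiff_add_fat_inter w B A
  have hwB5 := (h2 B hB).2
  have hcapB : capPaper B.card (fat w B) ≤ 3 := by
    rw [kB, capPaper_three_eq' (by omega)]
    omega
  have hcapA := capPaper_le_five (k := A.card) (f := fat w A) (by omega) (by omega)
  set T := (ls.erase A).erase B with hT
  have hTmem : ∀ Z ∈ T, Z ∈ ls ∧ Z ≠ A ∧ Z ≠ B := by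
    intro Z hZ
    rw [hT, Finset.mem_erase, Finset.mem_erase] at hZ
    exact ⟨hZ.2.2, hZ.2.1, hZ.1⟩
  have hB' : B ∈ ls.erase A := Finset.mem_erase.2 ⟨hBA, hB⟩
  rw [← Finset.add_sum_erase ls _ hA, ← Finset.add_sum_erase _ _ hB', ← hT]
  -- a second line after `B` forces `A = (4,0)`
  have hfatBA : 2 + fat w A ≤ fat w (B ∪ A) := by rw [fat_union_eq]; omega
  have hZ4 : ∀ Z ∈ T, A.card + fat w A ≤ 4 ∧ fat w Z ≤ 1 := by
    intro Z hZ
    obtain ⟨hZls, hZA, hZB⟩ := hTmem Z hZ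
    have hns := not_subset_union_A h3 hA hrest hZls hZA hB hZB
    have h := budget_one h1 h2 h4 hA hrest [Z, B] (by simp [hZB])
      (by simp [hZls, hZA, hB, hBA])
    have hnsB : ¬ B ⊆ A := fun hsub => by
      have := Finset.card_le_card hsub
      have hBU : B ∩ A = B := Finset.inter_eq_left.2 hsub
      have := h3 B hB A hA hBA
      rw [hBU] at this
      omega
    simp only [freeCountR, unionLR, if_neg hns, if_neg hnsB] at h
    have hmono := fat_mono w (Finset.subset_union_right (s₁ := Z) (s₂ := B ∪ A))
    refine ⟨by omega, ?_⟩
    -- `fat (Z ∪ (B ∪ A)) ≤ 2 = fat (B ∖ A) + ...`: `Z`'s fat points lie on `B`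
    have hsplit : fat w (Z ∪ (B ∪ A)) = fat w ((Z ∪ A) \ B) + fat w B := by
      rw [← fat_union_eq]
      congr 1
      ext u
      simp only [Finset.mem_union]
      tauto
    have hZB' : fat w (Z \ B) ≤ fat w ((Z ∪ A) \ B) := fat_mono w (Finset.sdiff_subset_sdiff Finset.subset_union_left le_rfl)
    have hfZ := fat_sdiff_add_fat_inter w Z B
    have hZBc : fat w (Z ∩ B) ≤ 1 := le_trans (Finset.card_le_card (Finset.filter_subset _ _)) (h3 Z hZls B hB hZB)
    omega
  rcases Finset.eq_empty_or_nonempty T with hempty | ⟨Z₀, hZ₀⟩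
  · rw [hempty, Finset.sum_empty]
    omega
  obtain ⟨hA4, -⟩ := hZ4 Z₀ hZ₀
  -- the other lines are chords through one hub with distinct points on `B`
  have hhub : ∀ Z ∈ T, ∀ Z' ∈ T, Z ≠ Z' → Z \ (B ∪ A) = Z' \ (B ∪ A) ∧ (Z \ (B ∪ A)).card = 1 := by
    intro Z hZ Z' hZ' hne
    obtain ⟨hZls, hZA, hZB⟩ := hTmem Z hZ
    obtain ⟨hZ'ls, hZ'A, hZ'B⟩ := hTmem Z' hZ'
    have hfree : ∀ l : List (Finset β), l.Nodup → (∀ L ∈ l, L ∈ T) → freeCountR (B ∪ A) l ≤ 1 := by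
      intro l hnd hl
      have hBl : B ∉ l := fun h => (hTmem B (hl B h)).2.2 rfl
      have h := budget_one h1 h2 h4 hA hrest (l ++ [B]) (List.Nodup.append hnd (List.nodup_singleton B)
        (fun X hXl hX' => hBl ((List.mem_singleton.1 hX') ▸ hXl)))
        (fun L hL => by
          rcases List.mem_append.1 hL with h | h
          · exact ⟨(hTmem L (hl L h)).1, (hTmem L (hl L h)).2.1⟩
          · rw [List.mem_singleton.1 h]; exact ⟨hB, hBA⟩)
      rw [freeCountR_append, unionLR_append] at h
      have hnsB : ¬ B ⊆ A := fun hsub => by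
        have hBU : B ∩ A = B := Finset.inter_eq_left.2 hsub
        have := h3 B hB A hA hBA
        rw [hBU] at this
        omega
      simp only [freeCountR, unionLR, if_neg hnsB] at h
      have hmono := fat_mono w (le_trans (Finset.subset_union_left (s₁ := B) (s₂ := A)) (subset_unionLR (B ∪ A) l))
      have hfB' : 2 ≤ fat w B := by omega
      omega
    exact sdiff_eq_of_free_le_one (not_subset_union_A h3 hA hrest hZls hZA hB hZB)
      (not_subset_union_A h3 hA hrest hZ'ls hZ'A hB hZ'B) (h3 Z hZls Z' hZ'ls hne)
      (hfree [Z', Z] (by simp [hne.symm]) (by simp [hZ, hZ']))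
      (hfree [Z, Z'] (by simp [hne]) (by simp [hZ, hZ']))
  have hTcard : T.card ≤ 3 := by
    rcases (by omega : T.card ≤ 1 ∨ 1 < T.card) with hle1 | hlt
    · omega
    have hc1 : ∀ Z ∈ T, (Z \ (B ∪ A)).card = 1 := by
      intro Z hZ
      obtain ⟨Z₁, hZ₁, hne⟩ : ∃ Z₁ ∈ T, Z₁ ≠ Z := by
        by_contra hc
        have hsub : T ⊆ {Z} := fun Y hY => Finset.mem_singleton.2 (by
          by_contra h
          exact hc ⟨Y, hY, h⟩)
        have := Finset.card_le_card hsub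
        rw [Finset.card_singleton] at this
        omega
      exact (hhub Z hZ Z₁ hZ₁ hne.symm).2
    -- inject `T` into `B.powersetCard 1` by `Z ↦ Z ∩ B`
    have hinj : T.card ≤ (B.powersetCard 1).card := by
      refine Finset.card_le_card_of_injOn (fun Z => Z ∩ B) ?_ ?_
      · intro Z hZ
        obtain ⟨hZls, hZA, hZB⟩ := hTmem Z hZ
        refine Finset.mem_powersetCard.2 ⟨Finset.inter_subset_right, ?_⟩
        -- `|Z ∩ B| = 1`: `Z` has two points in `B ∪ A`, at most one on each
        have hc1' := hc1 Z hZ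
        show (Z ∩ B).card = 1
        have hsplit := Finset.card_sdiff_add_card_inter Z (B ∪ A)
        have hle := card_inter_union_le Z B A
        have := h3 Z hZls B hB hZB
        have := h3 Z hZls A hA hZA
        have := hrest Z hZls hZA
        omega
      · intro Z hZ Z' hZ' hZZ'
        simp only at hZZ'
        by_contra hne
        obtain ⟨heq, hc1⟩ := hhub Z (Finset.mem_coe.1 hZ) Z' (Finset.mem_coe.1 hZ') hne
        obtain ⟨hZls, hZA, hZB⟩ := hTmem Z (Finset.mem_coe.1 hZ)
        obtain ⟨hZ'ls, -, -⟩ := hTmem Z' (Finset.mem_coe.1 hZ')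
        have hle := h3 Z hZls Z' hZ'ls hne
        obtain ⟨v, hv⟩ := Finset.card_eq_one.1 hc1
        have hvZ : v ∈ Z \ (B ∪ A) := hv ▸ Finset.mem_singleton_self v
        have hvZ' : v ∈ Z' \ (B ∪ A) := heq ▸ hvZ
        -- a point of `Z ∩ B`
        have hZBpos : 0 < (Z ∩ B).card := by
          have hsplit := Finset.card_sdiff_add_card_inter Z (B ∪ A)
          have hle' := card_inter_union_le Z B A
          have := h3 Z hZls A hA hZA
          have := hrest Z hZls hZA
          omega
        obtain ⟨b, hb⟩ := Finset.card_pos.1 hZBpos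
        have hb' : b ∈ Z' ∩ B := hZZ' ▸ hb
        have hbv : b ≠ v := fun h => (Finset.mem_sdiff.1 hvZ).2 (Finset.mem_union_left _ (h ▸ (Finset.mem_inter.1 hb).2))
        have hsub : {v, b} ⊆ Z ∩ Z' := by
          intro u hu
          rcases Finset.mem_insert.1 hu with rfl | hu
          · exact Finset.mem_inter.2 ⟨(Finset.mem_sdiff.1 hvZ).1, (Finset.mem_sdiff.1 hvZ').1⟩
          · rw [Finset.mem_singleton.1 hu]
            exact Finset.mem_inter.2 ⟨(Finset.mem_inter.1 hb).1, (Finset.mem_inter.1 hb').1⟩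
        have := Finset.card_le_card hsub
        rw [Finset.card_pair hbv.symm] at this
        omega
    rw [Finset.card_powersetCard, Nat.choose_one_right, kB] at hinj
    exact hinj
  have hsum : ∑ Z ∈ T, capPaper Z.card (fat w Z) ≤ 2 * T.card := by
    have hcap : ∀ Z ∈ T, capPaper Z.card (fat w Z) ≤ 2 := by
      intro Z hZ
      obtain ⟨hZls, hZA, hZB⟩ := hTmem Z hZ
      rw [hrest Z hZls hZA, capPaper_three_eq' (by have := (hZ4 Z hZ).2; omega)]
      have := (hZ4 Z hZ).2
      omega
    calc ∑ Z ∈ T, capPaper Z.card (fat w Z) ≤ ∑ _Z ∈ T, 2 := Finset.sum_le_sum hcap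
      _ = 2 * T.card := by rw [Finset.card_eq_sum_ones, Finset.mul_sum]; simp only [mul_one]
  have hcapA' : capPaper A.card (fat w A) = 4 := by
    have : A.card = 4 := by omega
    have : fat w A = 0 := by omega
    rw [‹A.card = 4›, ‹fat w A = 0›]; decide
  omega

include h1 h2 h3 h4 hA cA hrest in
/-- **(β′) Two new fat points on distinct lines**: then `A = (4,0)`, at most one other line through each, every
other line through one of them — cap sum `≤ 4 + 2 · 2`. -/
theorem sum_cap_le_of_two_new_fat_points (hβ : ∀ B ∈ ls, B ≠ A → fat w (B \ A) ≤ 1) {q r : β}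
    (hqA : q ∉ A) (hrA : r ∉ A) (hq2 : w q = 2) (hr2 : w r = 2) (hqr : q ≠ r) {B C : Finset β}
    (hB : B ∈ ls) (hBA : B ≠ A) (hqB : q ∈ B) (hC : C ∈ ls) (hCA : C ≠ A) (hrC : r ∈ C) :
    ∑ L ∈ ls, capPaper L.card (fat w L) ≤ 16 := by
  have h2A := h2 A hA
  have hwA := wsum_eq_card_add_fat w A (h1 A hA)
  set T := ls.erase A with hT
  have hTmem : ∀ Z ∈ T, Z ∈ ls ∧ Z ≠ A := fun Z hZ => ⟨(Finset.mem_erase.1 hZ).2, (Finset.mem_erase.1 hZ).1⟩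
  -- no line carries both `q` and `r`
  have hnot : ∀ Z ∈ ls, Z ≠ A → q ∈ Z → r ∈ Z → False := by
    intro Z hZ hZA hqZ hrZ
    have := hβ Z hZ hZA
    have := two_le_fat (Finset.mem_sdiff.2 ⟨hqZ, hqA⟩) (Finset.mem_sdiff.2 ⟨hrZ, hrA⟩) hqr hq2 hr2
    omega
  have hrB : r ∉ B := fun h => hnot B hB hBA hqB h
  have hqC : q ∉ C := fun h => hnot C hC hCA h hrC
  have hBC : B ≠ C := fun h => hrB (h ▸ hrC)
  -- the lines through `q`, then `C`: `deg q + 1` free lines, two new fat points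
  have hdegq : ((ls.erase A).filter (fun L => q ∈ L)).card + A.card + fat w A + 3 ≤ 8 := by
    set D := (ls.erase A).filter (fun L => q ∈ L) with hD
    have hmem : ∀ L ∈ D.toList, L ∈ ls ∧ L ≠ A ∧ q ∈ L := fun L hL => by
      have := Finset.mem_filter.1 (Finset.mem_toList.1 hL)
      exact ⟨(Finset.mem_erase.1 this.1).2, (Finset.mem_erase.1 this.1).1, this.2⟩
    have hCD : C ∉ D.toList := fun h => hqC (hmem C h).2.2
    have h := budget_one h1 h2 h4 hA hrest (C :: D.toList) (List.nodup_cons.2 ⟨hCD, Finset.nodup_toList D⟩)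
      (fun L hL => by
        rcases List.mem_cons.1 hL with rfl | hL
        · exact ⟨hC, hCA⟩
        · exact ⟨(hmem L hL).1, (hmem L hL).2.1⟩)
    rw [freeCountR_cons_of_new hrC hrA (fun L hL h => hnot L (hmem L hL).1 (hmem L hL).2.1 (hmem L hL).2.2 h),
      freeCountR_eq_length_of_mem' A D.toList (Finset.nodup_toList D)
        (fun L hL => ⟨hrest L (hmem L hL).1 (hmem L hL).2.1, (hmem L hL).2.2, h3 L (hmem L hL).1 A hA (hmem L hL).2.1⟩)
        (fun L hL L' hL' hne => h3 L (hmem L hL).1 L' (hmem L' hL').1 hne), Finset.length_toList] at h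
    have hqU : q ∈ unionLR A (C :: D.toList) :=
      mem_unionLR_of_mem (List.mem_cons_of_mem _ (Finset.mem_toList.2 (Finset.mem_filter.2
        ⟨Finset.mem_erase.2 ⟨hBA, hB⟩, hqB⟩))) hqB
    have hrU : r ∈ unionLR A (C :: D.toList) := mem_unionLR_of_mem List.mem_cons_self hrC
    have hfat : fat w A + 2 ≤ fat w (unionLR A (C :: D.toList)) := by
      have hsub : A.filter (fun v => w v = 2) ∪ {q, r} ⊆ (unionLR A (C :: D.toList)).filter (fun v => w v = 2) := by
        intro u hu
        rcases Finset.mem_union.1 hu with h | h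
        · exact Finset.mem_filter.2 ⟨subset_unionLR A _ (Finset.mem_filter.1 h).1, (Finset.mem_filter.1 h).2⟩
        · rcases Finset.mem_insert.1 h with rfl | h
          · exact Finset.mem_filter.2 ⟨hqU, hq2⟩
          · rw [Finset.mem_singleton.1 h]
            exact Finset.mem_filter.2 ⟨hrU, hr2⟩
      have hdisj : Disjoint (A.filter (fun v => w v = 2)) {q, r} := by
        rw [Finset.disjoint_left]
        intro u hu hu'
        rcases Finset.mem_insert.1 hu' with rfl | hu'
        · exact hqA (Finset.mem_filter.1 hu).1
        · rw [Finset.mem_singleton.1 hu'] at hu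
          exact hrA (Finset.mem_filter.1 hu).1
      have := Finset.card_le_card hsub
      rw [Finset.card_union_of_disjoint hdisj, Finset.card_pair hqr] at this
      exact this
    omega
  have hdegr : ((ls.erase A).filter (fun L => r ∈ L)).card + A.card + fat w A + 3 ≤ 8 := by
    -- symmetric: the lines through `r`, then `B`
    set D := (ls.erase A).filter (fun L => r ∈ L) with hD
    have hmem : ∀ L ∈ D.toList, L ∈ ls ∧ L ≠ A ∧ r ∈ L := fun L hL => by
      have := Finset.mem_filter.1 (Finset.mem_toList.1 hL)
      exact ⟨(Finset.mem_erase.1 this.1).2, (Finset.mem_erase.1 this.1).1, this.2⟩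
    have hBD : B ∉ D.toList := fun h => hrB (hmem B h).2.2
    have h := budget_one h1 h2 h4 hA hrest (B :: D.toList) (List.nodup_cons.2 ⟨hBD, Finset.nodup_toList D⟩)
      (fun L hL => by
        rcases List.mem_cons.1 hL with rfl | hL
        · exact ⟨hB, hBA⟩
        · exact ⟨(hmem L hL).1, (hmem L hL).2.1⟩)
    rw [freeCountR_cons_of_new hqB hqA (fun L hL h => hnot L (hmem L hL).1 (hmem L hL).2.1 h (hmem L hL).2.2),
      freeCountR_eq_length_of_mem' A D.toList (Finset.nodup_toList D)
        (fun L hL => ⟨hrest L (hmem L hL).1 (hmem L hL).2.1, (hmem L hL).2.2, h3 L (hmem L hL).1 A hA (hmem L hL).2.1⟩)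
        (fun L hL L' hL' hne => h3 L (hmem L hL).1 L' (hmem L' hL').1 hne), Finset.length_toList] at h
    have hrU : r ∈ unionLR A (B :: D.toList) :=
      mem_unionLR_of_mem (List.mem_cons_of_mem _ (Finset.mem_toList.2 (Finset.mem_filter.2
        ⟨Finset.mem_erase.2 ⟨hCA, hC⟩, hrC⟩))) hrC
    have hqU : q ∈ unionLR A (B :: D.toList) := mem_unionLR_of_mem List.mem_cons_self hqB
    have hfat : fat w A + 2 ≤ fat w (unionLR A (B :: D.toList)) := by
      have hsub : A.filter (fun v => w v = 2) ∪ {q, r} ⊆ (unionLR A (B :: D.toList)).filter (fun v => w v = 2) := by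
        intro u hu
        rcases Finset.mem_union.1 hu with h | h
        · exact Finset.mem_filter.2 ⟨subset_unionLR A _ (Finset.mem_filter.1 h).1, (Finset.mem_filter.1 h).2⟩
        · rcases Finset.mem_insert.1 h with rfl | h
          · exact Finset.mem_filter.2 ⟨hqU, hq2⟩
          · rw [Finset.mem_singleton.1 h]
            exact Finset.mem_filter.2 ⟨hrU, hr2⟩
      have hdisj : Disjoint (A.filter (fun v => w v = 2)) {q, r} := by
        rw [Finset.disjoint_left]
        intro u hu hu'
        rcases Finset.mem_insert.1 hu' with rfl | hu'
        · exact hqA (Finset.mem_filter.1 hu).1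
        · rw [Finset.mem_singleton.1 hu'] at hu
          exact hrA (Finset.mem_filter.1 hu).1
      have := Finset.card_le_card hsub
      rw [Finset.card_union_of_disjoint hdisj, Finset.card_pair hqr] at this
      exact this
    omega
  have hBD : B ∈ (ls.erase A).filter (fun L => q ∈ L) := Finset.mem_filter.2 ⟨Finset.mem_erase.2 ⟨hBA, hB⟩, hqB⟩
  have hpos := Finset.card_pos.2 ⟨B, hBD⟩
  -- every other line carries `q` or `r`
  have hall : ∀ Z ∈ T, q ∈ Z ∨ r ∈ Z := by
    intro Z hZ
    by_contra hc
    have hqZ : q ∉ Z := fun h => hc (Or.inl h)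
    have hrZ : r ∉ Z := fun h => hc (Or.inr h)
    obtain ⟨hZls, hZA⟩ := hTmem Z hZ
    have hZB : Z ≠ B := fun h => hqZ (h ▸ hqB)
    have hZC : Z ≠ C := fun h => hrZ (h ▸ hrC)
    have hbud := budget_one h1 h2 h4 hA hrest [C, B, Z] (by simp [hBC.symm, hZB.symm, hZC.symm])
      (by simp [hC, hCA, hB, hBA, hZls, hZA])
    have hnsZ : ¬ Z ⊆ A := fun hsub => by
      have hZU : Z ∩ A = Z := Finset.inter_eq_left.2 hsub
      have := h3 Z hZls A hA hZA
      rw [hZU] at this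
      have := hrest Z hZls hZA
      omega
    rw [freeCountR_cons_of_new hrC hrA (fun L hL hrL => by
        simp only [List.mem_cons, List.not_mem_nil, or_false] at hL
        rcases hL with hL | hL
        · exact hrB (hL ▸ hrL)
        · exact hrZ (hL ▸ hrL)),
      freeCountR_cons_of_new hqB hqA (fun L hL hqL => by
        simp only [List.mem_cons, List.not_mem_nil, or_false] at hL
        exact hqZ (hL ▸ hqL))] at hbud
    simp only [freeCountR, unionLR, if_neg hnsZ] at hbud
    have hfat := two_le_fat (S := unionLR A [C, B, Z]) (mem_unionLR_of_mem (List.mem_cons_of_mem _ List.mem_cons_self) hqB)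
      (mem_unionLR_of_mem List.mem_cons_self hrC) hqr hq2 hr2
    simp only [unionLR] at hfat
    omega
  have hTsub : T ⊆ (ls.erase A).filter (fun L => q ∈ L) ∪ (ls.erase A).filter (fun L => r ∈ L) := by
    intro Z hZ
    rcases hall Z hZ with h | h
    · exact Finset.mem_union_left _ (Finset.mem_filter.2 ⟨hZ, h⟩)
    · exact Finset.mem_union_right _ (Finset.mem_filter.2 ⟨hZ, h⟩)
  have hTcard : T.card ≤ 2 := by
    have := Finset.card_le_card hTsub
    have := Finset.card_union_le ((ls.erase A).filter (fun L => q ∈ L)) ((ls.erase A).filter (fun L => r ∈ L))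
    omega
  rw [← Finset.add_sum_erase ls _ hA, ← hT]
  have hcap : ∀ Z ∈ T, capPaper Z.card (fat w Z) ≤ 2 := by
    intro Z hZ
    obtain ⟨hZls, hZA⟩ := hTmem Z hZ
    have hfZ := fat_sdiff_add_fat_inter w Z A
    have hfA : fat w (Z ∩ A) = 0 := by
      have : fat w A = 0 := by omega
      have := fat_mono w (Finset.inter_subset_right (s₁ := Z) (s₂ := A))
      omega
    have := hβ Z hZls hZA
    rw [hrest Z hZls hZA, capPaper_three_eq' (by omega)]
    omega
  have hsum : ∑ Z ∈ T, capPaper Z.card (fat w Z) ≤ 2 * T.card := by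
    calc ∑ Z ∈ T, capPaper Z.card (fat w Z) ≤ ∑ _Z ∈ T, 2 := Finset.sum_le_sum hcap
      _ = 2 * T.card := by rw [Finset.card_eq_sum_ones, Finset.mul_sum]; simp only [mul_one]
  have hcapA := capPaper_le_five (k := A.card) (f := fat w A) (by omega) (by omega)
  omega

end OneBigCases

end FourCap

end S1

end PercRepro
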